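import Summits.QuantumFields.YangMills.Theorems.PoincareLipschitzHistoryTailOfSobolevStubs
import Summits.QuantumFields.YangMills.Theorems.PoincareLipschitzMinimiserMonotonicity
import Literature.Analysis.PDE.HarmonicMapMinimisers
import Summits.QuantumFields.YangMills.Theorems.PoincareLipschitzCompactnessTransferLatticeToContinuumLimitStub
import HarnessLib

/-!
# Crux `HistoryTailL` (stmt-QuantumFields-19936) BY NAME, modulo {K1 (exponential OR Poincaré), TWO NAMED PRINT FACTS, `MeanDeviationL`} —
# FILE K-11: the K2 display v7 «THE CONTINUUM FACE IS NAMED PRINT, THE LATTICE FACE IS A THEOREM»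

Cell `ym3-torus` (YM ladder rung R3 = continuum SU(2) Yang–Mills on T³ — a RUNG, NOT the Clay problem: not d = 4, not infinite volume, not a mass gap);
LEAD seat `ym-ust-19936-w1` g10.  Helper `--supports stmt-QuantumFields-19936`; THEOREMS ONLY; two one-line compositions over landed files: display v5
✓`PoincareLipschitzHistoryTailOfSobolevStubs.historyTailL_of_stubs (hK1)(h1)(h2)(hM)` (K-8b), px3 g8's STUB alias ✓p724606
`PoincareLipschitzCompactnessTransferLatticeToContinuumLimitStub.stub_latticeToContinuumLimit : ⟨S2♭″⟩` (hypothesis-free: the Γ-knit ✓p721569 over ★w8 (Γ2-W), LEAD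
(Γ2-IBP), px5 (Γ2-lsc-ε ∕ Γ5 door ✓p722329), px15 (Γ5a∕Γ5-B), w7 (Γ5b′∕Γ5-C), w4 g15 (Γ5-D), px3 (L)(M)(S)(C)(K-a)(K-b); Γ1 px3 g7 ✓p718032) and ★w3 g15 ⊕ w2 g13's knit
✓`PoincareLipschitzMinimiserMonotonicity.uniformSmallScaleEnergy_band_of_compactness_smoothness (hCpt) (hRegS) : ⟨S1″-band⟩` — in which the monotonicity
formula [Simon1996 §2.4 (ii)] is PROVED in the tree (`hMono_holds`, from w2 g13's radial variation ✓p722794) and the two remaining print rows are the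
Literature NAMED FACTS ✓p723396 `Literature.Analysis.PDE.MinimisingMapCompactness` [Simon1996 §2.9 Lemma 1 ∕ Luckhaus1988] and
`Literature.Analysis.PDE.MinimisingMapSmoothness` [SchoenUhlenbeck1984] (texts = the knit's rows (C), (RS) token for token, so `hC`, `hR` feed it by `δ`).
EVERY LATTICE STATEMENT OF THE K2 ORGAN IS NOW A THEOREM OF THE TREE; the continuum input is two named printed theorems.

THE DISPLAYED BINDERS.  `hK1` = K1-exp resp. `hVar` = the Poincaré row (v2–v6 VERBATIM); `hC : MinimisingMapCompactness`, `hR : MinimisingMapSmoothness`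
(NAMED FACTS, D-0014 — the conditional-result trust base of the continuum face); `hM` = `PoincareLipschitz.MeanDeviationL` (stmt-QuantumFields-23083).
Census v6 → v7: removed [hMono, hCpt, hReg, h2] · added [hC, hR] · changed [].  NOTHING of K1, the two facts or `MeanDeviationL` is proved here;
`HistoryTailL` is NOT proved.

WHAT IS PROVED (ns `…Theorems.PoincareLipschitzHistoryTailOfFacts`).
* ★★★ `historyTailL_of_facts (hK1) (hC) (hR) (hM) : UnitScaleTilt.HistoryTailL`.
* ★★★ `historyTailL_of_poincare_of_facts (hVar) (hC) (hR) (hM) : UnitScaleTilt.HistoryTailL`.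
HONEST SCOPE.  Compositions by landed names only; YM₃ on T³ is rung R3, not Clay; YM gap NOT proved.

References: T. Bałaban, CMP 102 (1985) 255–275 [Balaban1985UV3]; L. Simon (1996) [Simon1996]; S. Luckhaus (1988) [Luckhaus1988]; R. Schoen, K. Uhlenbeck,
Invent. Math. 78 (1984) 89–100 [SchoenUhlenbeck1984]; D. Bakry, I. Gentil, M. Ledoux (2014) [BakryGentilLedoux2014].
-/

set_option autoImplicit false

noncomputable section

namespace Summit.QuantumFields.YangMills.Theorems.PoincareLipschitzHistoryTailOfFacts

open MeasureTheory Filter Topology Finset Metric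
open scoped BigOperators
open Literature.Analysis.FunctionSpaces
open Literature.Analysis.PDE (MinimisingMapCompactness MinimisingMapSmoothness)
open Literature.MathematicalPhysics.QuantumFieldTheory.Balaban1983to89
open Literature.MathematicalPhysics.QuantumFieldTheory.Balaban1983to89.T3ContinuumYM3Torus
open Literature.MathematicalPhysics.QuantumFieldTheory.Balaban1983to89.T3UnitScaleTilt
open Literature.MathematicalPhysics.QuantumFieldTheory.Balaban1983to89.T3UnitLawDensityEML (ℰp)
open B4Eq19LatticeOperators (Zd box unitVec)
open Summit.QuantumFields.YangMills.Theorems.PoincareLipschitzHistoryTailOfSobolevStubs (historyTailL_of_stubs historyTailL_of_poincare_of_stubs)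
open Summit.QuantumFields.YangMills.Theorems.PoincareLipschitzMinimiserMonotonicity (uniformSmallScaleEnergy_band_of_compactness_smoothness)
open Summit.QuantumFields.YangMills.Theorems.PoincareLipschitzCompactnessTransferLatticeToContinuumLimitStub (stub_latticeToContinuumLimit)

/-- ★★★ **THE CRUX BY NAME FROM K1-exp, THE NAMED FACTS `MinimisingMapCompactness` ∕ `MinimisingMapSmoothness` AND `MeanDeviationL`** (display v7).
[cite: Balaban1985UV3, (71) p.273; Simon1996, §2.9 Lemma 1; SchoenUhlenbeck1984, Thm] -/
theorem historyTailL_of_facts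
    (hK1 : ∀ (L : ℕ), ∃ (Cc cc : ℝ), 0 ≤ Cc ∧ 0 < cc ∧ ∃ γ₁ : ℝ, 0 < γ₁ ∧ γ₁ ≤ 1 ∧
      ∀ (F : T3Family) (γ : ℝ), F.L = L → 0 < γ → γ ≤ γ₁ → ∀ (K n : ℕ), 1 ≤ n →
        (n : ℝ) ≤ (F.scheme ℰp γ).β K → 2 * n ≤ (F.P K).sitesPerDir 0 →
        ∀ (x₀ : Site (F.P K) 0) (f : GaugeField (F.P K) 0 (Matrix.specialUnitaryGroup (Fin 2) ℂ) → ℝ) (Λ : ℝ), 0 < Λ →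
          Measurable f → GaugeField.GaugeInvariant f →
          (∀ U U' : GaugeField (F.P K) 0 (Matrix.specialUnitaryGroup (Fin 2) ℂ),
            (∀ b : PBond (F.P K) 0, (∀ k, (b.src k - x₀ k).val < n) → (∀ k, (b.tgt k - x₀ k).val < n) → U b = U' b) →
              f U = f U') →
          (∀ U U' : GaugeField (F.P K) 0 (Matrix.specialUnitaryGroup (Fin 2) ℂ),
            |f U - f U'| ≤ Λ * Real.sqrt (∑ b : PBond (F.P K) 0, GaugeGroup.dist1 (U b * (U' b)⁻¹) ^ 2)) →
          ∀ r : ℝ, 0 ≤ r →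
            (gibbsK F ℰp γ K).real {U | r ≤ f U - ∫ V, f V ∂(gibbsK F ℰp γ K)} ≤
              Cc * Real.exp (-(cc * Real.sqrt ((F.scheme ℰp γ).β K) * r / ((n : ℝ) * Λ))))
    (hC : MinimisingMapCompactness) (hR : MinimisingMapSmoothness)
    (hM : Summit.QuantumFields.YangMills.Theses.PoincareLipschitz.MeanDeviationL) :
    Summit.QuantumFields.YangMills.Theses.UnitScaleTilt.HistoryTailL :=
  historyTailL_of_stubs hK1 (uniformSmallScaleEnergy_band_of_compactness_smoothness hC hR) stub_latticeToContinuumLimit hM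

/-- ★★★ **THE CRUX BY NAME FROM THE POINCARÉ INEQUALITY FOR `gibbsK`, THE TWO NAMED FACTS AND `MeanDeviationL`** (display v7, Poincaré K1 row).
[cite: BakryGentilLedoux2014, Prop. 4.4.2; Balaban1985UV3, (71) p.273; Simon1996, §2.9 Lemma 1; SchoenUhlenbeck1984, Thm] -/
theorem historyTailL_of_poincare_of_facts
    (hVar : ∀ (L : ℕ), ∃ cV : ℝ, 0 < cV ∧ ∃ γ₁ : ℝ, 0 < γ₁ ∧ γ₁ ≤ 1 ∧
      ∀ (F : T3Family) (γ : ℝ), F.L = L → 0 < γ → γ ≤ γ₁ → ∀ (K n : ℕ), 1 ≤ n →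
        (n : ℝ) ≤ (F.scheme ℰp γ).β K → 2 * n ≤ (F.P K).sitesPerDir 0 →
        ∀ (x₀ : Site (F.P K) 0) (f : GaugeField (F.P K) 0 (Matrix.specialUnitaryGroup (Fin 2) ℂ) → ℝ) (Λ : ℝ), 0 < Λ →
          Measurable f → GaugeField.GaugeInvariant f →
          (∀ U U' : GaugeField (F.P K) 0 (Matrix.specialUnitaryGroup (Fin 2) ℂ),
            (∀ b : PBond (F.P K) 0, (∀ k, (b.src k - x₀ k).val < n) → (∀ k, (b.tgt k - x₀ k).val < n) → U b = U' b) →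
              f U = f U') →
          (∀ U U' : GaugeField (F.P K) 0 (Matrix.specialUnitaryGroup (Fin 2) ℂ),
            |f U - f U'| ≤ Λ * Real.sqrt (∑ b : PBond (F.P K) 0, GaugeGroup.dist1 (U b * (U' b)⁻¹) ^ 2)) →
          ∀ l : ℝ,
            ∫ U, Real.exp (l * f U) ∂(gibbsK F ℰp γ K) - (∫ U, Real.exp (l / 2 * f U) ∂(gibbsK F ℰp γ K)) ^ 2 ≤
              cV * ((n : ℝ) ^ 2 * Λ ^ 2 / (F.scheme ℰp γ).β K) * l ^ 2 * ∫ U, Real.exp (l * f U) ∂(gibbsK F ℰp γ K))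
    (hC : MinimisingMapCompactness) (hR : MinimisingMapSmoothness)
    (hM : Summit.QuantumFields.YangMills.Theses.PoincareLipschitz.MeanDeviationL) :
    Summit.QuantumFields.YangMills.Theses.UnitScaleTilt.HistoryTailL :=
  historyTailL_of_poincare_of_stubs hVar (uniformSmallScaleEnergy_band_of_compactness_smoothness hC hR) stub_latticeToContinuumLimit hM

end Summit.QuantumFields.YangMills.Theorems.PoincareLipschitzHistoryTailOfFacts

end
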